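import Summits.AtomisticToContinuum.Crystallization.Theorems.FreeSplittingCertificatesStrictSplittingRuleP1ReadCell

/-!
# `StrictSplittingRule` (stmt-AtomisticToContinuum-12560): READOUT REGROUPING — the lattice readout of the stencil `Y` (three in-layer bonds + the vertical Bravais bond) is bounded by a CELL-indexed capacity form of the interpolant's gradients (P1 interpolant object, part 36)

Route `FreeSplittingCertificates`, crux r3 `StrictSplittingRule` (H12⋆ = `stub_coreJointCoercive`), unit b2b-freesplit-B gen 24.
VALUE = the bookkeeping step (R) of the demand side (HOME FAR-LEMMA-SPEC §18 (d), CERT §27 (3)) in its simplest allocation: every in-layer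
bond `(q, q+s)`, `s ∈ {(0,1,0), (0,0,1), (0,−1,1)}`, is booked on ONE designated corner tetrahedron having it as an edge (even `q.1`: piece 0 of the
even cube `q − o_s`, `o = 0, 0, (0,1,0)`; odd `q.1`: piece 1 of the odd cube `q − o_s`, `o = (0,0,1), (0,1,0), (0,1,0)`), and the vertical bond
`(q, q+(2,0,0))` on its tetrahedron pair (part 33/34).  For nonnegative bond weights `w, w_v` and lattice values `V`:
* **`tsum_readout_inlayer_le`**: `Σ'_q Σ_s w(q,s)·|V(q+s) − V(q)|² ≤ Σ'_n Λ_in(n)·|G_{(n, π(n))}|²_F`, `π(n) = 0 / 1` for even / odd `n.1`,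
  `Λ_in(n) = Σ_s w(n + o_s, s)·|y_s|²` (the three designated bonds of cube `n`);
* **`tsum_readout_vertical_le`**: `Σ'_q w_v(q)·|V(q+(2,0,0)) − V(q)|² ≤ Σ'_n 2h²·[w_v-terms of the ≤ 2 vertical bonds through the corner tets of cube n]·|G|²`.
Both under summability of the right-hand families (discharged in the assembly from the decay of the far shares); proof = per-bond capacity
(`p1Cell_readout_le`-type Cauchy–Schwarz, `p1_vertical_readout_le_*`) + reindexing `q = n + o` per designated slot (`Equiv.addRight`) + finite sums of
tsums.  The allocation is deliberately crude (one cell per bond); the re-weighted multi-cell allocation of `code/partB/gen24-budget/cellbudget.py`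
replaces the designation table without changing the proof pattern.  NOT a proof of H12⋆, NOT summit progress.  [folklore]
-/

noncomputable section

open Set Function
open scoped BigOperators

namespace Summit.AtomisticToContinuum.Crystallization.Theorems.StrictSplittingRuleBirth

open Literature.MathematicalPhysics.StatisticalMechanics
open Summit.AtomisticToContinuum.Crystallization.Theorems.PalmUnimodularRigidity.LayeredLawsSelectHcp

/-! ## One designated cell per in-layer bond -/

/-- **Per-bond capacity, designated cell**: if `q = n + v_m` and `q' = n + v_{m'}` are vertices `m, m'` of the cell `i = (n, π)`, then
`|V q' − V q|² ≤ |y_{q'} − y_q|²·|G_i|²_F`. -/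
theorem p1_bond_readout_le {a h : ℝ} (ha : a ≠ 0) (hh : h ≠ 0) (V : ℤ × ℤ × ℤ → (Fin 3 → ℝ)) (i : (ℤ × ℤ × ℤ) × Fin 6)
    (m m' : Fin 4) {q q' : ℤ × ℤ × ℤ} (hq : q = i.1 + p1VertOff (p1Par i.1) i.2 m) (hq' : q' = i.1 + p1VertOff (p1Par i.1) i.2 m') :
    fpSq (fun k => V q' k - V q k) ≤ fpSq (fun k => hcpSite a h q' k - hcpSite a h q k) * fpFrob (p1CellGrad a h V i) := by
  subst hq hq'
  have heq : (fun k => V (i.1 + p1VertOff (p1Par i.1) i.2 m') k - V (i.1 + p1VertOff (p1Par i.1) i.2 m) k) = fun k =>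
      (hcpSite a h (i.1 + p1VertOff (p1Par i.1) i.2 m') 0 - hcpSite a h (i.1 + p1VertOff (p1Par i.1) i.2 m) 0) * p1CellGrad a h V i 0 k +
      (hcpSite a h (i.1 + p1VertOff (p1Par i.1) i.2 m') 1 - hcpSite a h (i.1 + p1VertOff (p1Par i.1) i.2 m) 1) * p1CellGrad a h V i 1 k +
      (hcpSite a h (i.1 + p1VertOff (p1Par i.1) i.2 m') 2 - hcpSite a h (i.1 + p1VertOff (p1Par i.1) i.2 m) 2) * p1CellGrad a h V i 2 k := by
    funext k
    exact p1CellVals_sub_eq_grad ha hh V i m' m k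
  rw [heq]
  exact fpSq_vecMul_le (fun k => hcpSite a h (i.1 + p1VertOff (p1Par i.1) i.2 m') k - hcpSite a h (i.1 + p1VertOff (p1Par i.1) i.2 m) k)
    (p1CellGrad a h V i)

/-- **In-layer bond `(0,1,0)` on its designated cell** (cube `q`, piece 0 / quarter 3). -/
theorem p1_bond1_le {a h : ℝ} (ha : a ≠ 0) (hh : h ≠ 0) (V : ℤ × ℤ × ℤ → (Fin 3 → ℝ)) (q : ℤ × ℤ × ℤ) :
    fpSq (fun k => V (q + (0, 1, 0)) k - V q k) ≤
      fpSq (fun k => hcpSite a h (q + (0, 1, 0)) k - hcpSite a h q k) *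
        fpFrob (p1CellGrad a h V (q, if Even q.1 then (0 : Fin 6) else 3)) := by
  by_cases hq : Even q.1
  · have hp : p1Par q = true := by simp [p1Par, hq]
    simp only [hq, if_true]
    refine p1_bond_readout_le ha hh V (q, 0) 0 2 ?_ ?_ <;> (dsimp only; rw [hp]) <;> ext <;> simp [p1VertOff]
  · have hp : p1Par q = false := by simp [p1Par, hq]
    simp only [hq, if_false]
    refine p1_bond_readout_le ha hh V (q, 3) 3 1 ?_ ?_ <;> (dsimp only; rw [hp]) <;> ext <;> simp [p1VertOff]

/-- **In-layer bond `(0,0,1)` on its designated cell** (cube `q`, piece 0 / quarter 4). -/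
theorem p1_bond2_le {a h : ℝ} (ha : a ≠ 0) (hh : h ≠ 0) (V : ℤ × ℤ × ℤ → (Fin 3 → ℝ)) (q : ℤ × ℤ × ℤ) :
    fpSq (fun k => V (q + (0, 0, 1)) k - V q k) ≤
      fpSq (fun k => hcpSite a h (q + (0, 0, 1)) k - hcpSite a h q k) *
        fpFrob (p1CellGrad a h V (q, if Even q.1 then (0 : Fin 6) else 4)) := by
  by_cases hq : Even q.1
  · have hp : p1Par q = true := by simp [p1Par, hq]
    simp only [hq, if_true]
    refine p1_bond_readout_le ha hh V (q, 0) 0 3 ?_ ?_ <;> (dsimp only; rw [hp]) <;> ext <;> simp [p1VertOff]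
  · have hp : p1Par q = false := by simp [p1Par, hq]
    simp only [hq, if_false]
    refine p1_bond_readout_le ha hh V (q, 4) 2 3 ?_ ?_ <;> (dsimp only; rw [hp]) <;> ext <;> simp [p1VertOff]

/-- **In-layer bond `(0,−1,1)` on its designated cell** (cube `q − (0,1,0)`, piece 0 / piece 1). -/
theorem p1_bond3_le {a h : ℝ} (ha : a ≠ 0) (hh : h ≠ 0) (V : ℤ × ℤ × ℤ → (Fin 3 → ℝ)) (q : ℤ × ℤ × ℤ) :
    fpSq (fun k => V (q + (0, -1, 1)) k - V q k) ≤
      fpSq (fun k => hcpSite a h (q + (0, -1, 1)) k - hcpSite a h q k) *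
        fpFrob (p1CellGrad a h V (q - (0, 1, 0), if Even q.1 then (0 : Fin 6) else 1)) := by
  by_cases hq : Even q.1
  · have hp : p1Par (q - (0, 1, 0)) = true := by simp [p1Par, hq]
    simp only [hq, if_true]
    refine p1_bond_readout_le ha hh V (q - (0, 1, 0), 0) 2 3 ?_ ?_ <;> (dsimp only; rw [hp]) <;> ext <;>
      simp [p1VertOff, ← sub_eq_add_neg]
  · have hp : p1Par (q - (0, 1, 0)) = false := by simp [p1Par, hq]
    simp only [hq, if_false]
    refine p1_bond_readout_le ha hh V (q - (0, 1, 0), 1) 3 2 ?_ ?_ <;> (dsimp only; rw [hp]) <;> ext <;>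
      simp [p1VertOff, ← sub_eq_add_neg]

/-! ## The in-layer regrouping -/

/-- Reindexing a nonnegative summable family by a translation of `ℤ³`. -/
theorem tsum_translate (f : ℤ × ℤ × ℤ → ℝ) (o : ℤ × ℤ × ℤ) : ∑' q, f q = ∑' n, f (n + o) :=
  ((Equiv.addRight o).tsum_eq f).symm

/-- **THE IN-LAYER READOUT REGROUPING**: for nonnegative bond weights `w q s` (`s = 0, 1, 2` ↔ `(0,1,0), (0,0,1), (0,−1,1)`) and lattice values `V`,
`Σ'_q Σ_s w(q,s)|V(q+s)−V(q)|² ≤ Σ'_n [w(n,0)|y|²·|G_{(n,π₁)}|² + w(n,1)|y|²·|G_{(n,π₂)}|² + w(n+(0,1,0),2)|y|²·|G_{(n,π₃)}|²]` with the designated pieces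
`(π₁,π₂,π₃) = (0,0,0)` on even cubes, `(3,4,1)` on odd cubes, provided the right-hand family is summable.  NOT a proof of H12⋆, NOT summit progress. -/
theorem tsum_readout_inlayer_le {a h : ℝ} (ha : a ≠ 0) (hh : h ≠ 0) (V : ℤ × ℤ × ℤ → (Fin 3 → ℝ)) (w : ℤ × ℤ × ℤ → Fin 3 → ℝ)
    (hw : ∀ q s, 0 ≤ w q s)
    (hs : Summable fun n : ℤ × ℤ × ℤ =>
      w n 0 * fpSq (fun k => hcpSite a h (n + (0, 1, 0)) k - hcpSite a h n k) * fpFrob (p1CellGrad a h V (n, if Even n.1 then (0 : Fin 6) else 3)) +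
      w n 1 * fpSq (fun k => hcpSite a h (n + (0, 0, 1)) k - hcpSite a h n k) * fpFrob (p1CellGrad a h V (n, if Even n.1 then (0 : Fin 6) else 4)) +
      w (n + (0, 1, 0)) 2 * fpSq (fun k => hcpSite a h (n + (0, 1, 0) + (0, -1, 1)) k - hcpSite a h (n + (0, 1, 0)) k) *
        fpFrob (p1CellGrad a h V (n, if Even n.1 then (0 : Fin 6) else 1))) :
    Summable (fun q => w q 0 * fpSq (fun k => V (q + (0, 1, 0)) k - V q k) + w q 1 * fpSq (fun k => V (q + (0, 0, 1)) k - V q k) +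
      w q 2 * fpSq (fun k => V (q + (0, -1, 1)) k - V q k)) ∧
    ∑' q, (w q 0 * fpSq (fun k => V (q + (0, 1, 0)) k - V q k) + w q 1 * fpSq (fun k => V (q + (0, 0, 1)) k - V q k) +
      w q 2 * fpSq (fun k => V (q + (0, -1, 1)) k - V q k)) ≤
    ∑' n : ℤ × ℤ × ℤ,
      (w n 0 * fpSq (fun k => hcpSite a h (n + (0, 1, 0)) k - hcpSite a h n k) * fpFrob (p1CellGrad a h V (n, if Even n.1 then (0 : Fin 6) else 3)) +
      w n 1 * fpSq (fun k => hcpSite a h (n + (0, 0, 1)) k - hcpSite a h n k) * fpFrob (p1CellGrad a h V (n, if Even n.1 then (0 : Fin 6) else 4)) +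
      w (n + (0, 1, 0)) 2 * fpSq (fun k => hcpSite a h (n + (0, 1, 0) + (0, -1, 1)) k - hcpSite a h (n + (0, 1, 0)) k) *
        fpFrob (p1CellGrad a h V (n, if Even n.1 then (0 : Fin 6) else 1))) := by
  -- the three bounding families, indexed by the bond's tail q
  set B1 : ℤ × ℤ × ℤ → ℝ := fun q => w q 0 * fpSq (fun k => hcpSite a h (q + (0, 1, 0)) k - hcpSite a h q k) *
    fpFrob (p1CellGrad a h V (q, if Even q.1 then (0 : Fin 6) else 3)) with hB1
  set B2 : ℤ × ℤ × ℤ → ℝ := fun q => w q 1 * fpSq (fun k => hcpSite a h (q + (0, 0, 1)) k - hcpSite a h q k) *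
    fpFrob (p1CellGrad a h V (q, if Even q.1 then (0 : Fin 6) else 4)) with hB2
  set B3 : ℤ × ℤ × ℤ → ℝ := fun q => w q 2 * fpSq (fun k => hcpSite a h (q + (0, -1, 1)) k - hcpSite a h q k) *
    fpFrob (p1CellGrad a h V (q - (0, 1, 0), if Even q.1 then (0 : Fin 6) else 1)) with hB3
  have hF0 : ∀ i, 0 ≤ fpFrob (p1CellGrad a h V i) := fun i => by unfold fpFrob; positivity
  have hS0 : ∀ f : Fin 3 → ℝ, 0 ≤ fpSq f := fun f => by unfold fpSq; positivity
  have h10 : ∀ q, 0 ≤ B1 q := fun q => mul_nonneg (mul_nonneg (hw q 0) (hS0 _)) (hF0 _)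
  have h20 : ∀ q, 0 ≤ B2 q := fun q => mul_nonneg (mul_nonneg (hw q 1) (hS0 _)) (hF0 _)
  have h30 : ∀ q, 0 ≤ B3 q := fun q => mul_nonneg (mul_nonneg (hw q 2) (hS0 _)) (hF0 _)
  -- the cell-indexed family is B1 n + B2 n + B3 (n + (0,1,0))
  have hB3s : ∀ n : ℤ × ℤ × ℤ, B3 (n + (0, 1, 0)) = w (n + (0, 1, 0)) 2 *
      fpSq (fun k => hcpSite a h (n + (0, 1, 0) + (0, -1, 1)) k - hcpSite a h (n + (0, 1, 0)) k) *
        fpFrob (p1CellGrad a h V (n, if Even n.1 then (0 : Fin 6) else 1)) := by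
    intro n
    simp only [hB3, add_sub_cancel_right, Prod.fst_add, add_zero]
  have hcell : (fun n : ℤ × ℤ × ℤ =>
      w n 0 * fpSq (fun k => hcpSite a h (n + (0, 1, 0)) k - hcpSite a h n k) * fpFrob (p1CellGrad a h V (n, if Even n.1 then (0 : Fin 6) else 3)) +
      w n 1 * fpSq (fun k => hcpSite a h (n + (0, 0, 1)) k - hcpSite a h n k) * fpFrob (p1CellGrad a h V (n, if Even n.1 then (0 : Fin 6) else 4)) +
      w (n + (0, 1, 0)) 2 * fpSq (fun k => hcpSite a h (n + (0, 1, 0) + (0, -1, 1)) k - hcpSite a h (n + (0, 1, 0)) k) *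
        fpFrob (p1CellGrad a h V (n, if Even n.1 then (0 : Fin 6) else 1))) = fun n => B1 n + B2 n + B3 (n + (0, 1, 0)) := by
    funext n; rw [hB3s]
  rw [hcell] at hs ⊢
  -- summability of each family
  have hs1 : Summable B1 := Summable.of_nonneg_of_le h10 (fun n => by linarith [h20 n, h30 (n + (0, 1, 0))]) hs
  have hs2 : Summable B2 := Summable.of_nonneg_of_le h20 (fun n => by linarith [h10 n, h30 (n + (0, 1, 0))]) hs
  have hs3' : Summable fun n => B3 (n + (0, 1, 0)) := Summable.of_nonneg_of_le (fun n => h30 _) (fun n => by linarith [h10 n, h20 n]) hs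
  have hs3 : Summable B3 := by
    have e := (Equiv.addRight ((0, 1, 0) : ℤ × ℤ × ℤ)).summable_iff (f := B3)
    exact e.1 hs3'
  -- termwise bound of the bond family
  have hle : ∀ q, w q 0 * fpSq (fun k => V (q + (0, 1, 0)) k - V q k) + w q 1 * fpSq (fun k => V (q + (0, 0, 1)) k - V q k) +
      w q 2 * fpSq (fun k => V (q + (0, -1, 1)) k - V q k) ≤ B1 q + B2 q + B3 q := by
    intro q
    have e1 := mul_le_mul_of_nonneg_left (p1_bond1_le ha hh V q) (hw q 0)
    have e2 := mul_le_mul_of_nonneg_left (p1_bond2_le ha hh V q) (hw q 1)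
    have e3 := mul_le_mul_of_nonneg_left (p1_bond3_le ha hh V q) (hw q 2)
    simp only [hB1, hB2, hB3]
    linarith
  have hb0 : ∀ q, 0 ≤ w q 0 * fpSq (fun k => V (q + (0, 1, 0)) k - V q k) + w q 1 * fpSq (fun k => V (q + (0, 0, 1)) k - V q k) +
      w q 2 * fpSq (fun k => V (q + (0, -1, 1)) k - V q k) :=
    fun q => add_nonneg (add_nonneg (mul_nonneg (hw q 0) (hS0 _)) (mul_nonneg (hw q 1) (hS0 _))) (mul_nonneg (hw q 2) (hS0 _))
  have hsumB : Summable fun q => B1 q + B2 q + B3 q := (hs1.add hs2).add hs3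
  have hbond : Summable (fun q => w q 0 * fpSq (fun k => V (q + (0, 1, 0)) k - V q k) + w q 1 * fpSq (fun k => V (q + (0, 0, 1)) k - V q k) +
      w q 2 * fpSq (fun k => V (q + (0, -1, 1)) k - V q k)) := Summable.of_nonneg_of_le hb0 hle hsumB
  refine ⟨hbond, ?_⟩
  calc ∑' q, (w q 0 * fpSq (fun k => V (q + (0, 1, 0)) k - V q k) + w q 1 * fpSq (fun k => V (q + (0, 0, 1)) k - V q k) +
        w q 2 * fpSq (fun k => V (q + (0, -1, 1)) k - V q k))
      ≤ ∑' q, (B1 q + B2 q + B3 q) := Summable.tsum_le_tsum hle hbond hsumB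
    _ = (∑' q, B1 q) + (∑' q, B2 q) + ∑' q, B3 q := by rw [(hs1.add hs2).tsum_add hs3, hs1.tsum_add hs2]
    _ = (∑' n, B1 n) + (∑' n, B2 n) + ∑' n, B3 (n + (0, 1, 0)) := by rw [tsum_translate B3 (0, 1, 0)]
    _ = ∑' n, (B1 n + B2 n + B3 (n + (0, 1, 0))) := by rw [(hs1.add hs2).tsum_add hs3', hs1.tsum_add hs2]

/-! ## The vertical regrouping -/

/-- **THE VERTICAL READOUT REGROUPING**: for nonnegative weights `w_v` and lattice values `V`,
`Σ'_q w_v(q)|V(q+(2,0,0))−V(q)|² ≤ Σ'_n [C₁(n) + C₂(n)]` with `C₁(n) = 2h²·w_v(apex of the down-tet of cube n)·|G_{(n, down-tet)}|²`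
(`n + (0,1,1)`, piece 1 on even cubes; `n`, piece 0 on odd cubes) and `C₂(n) = 2h²·w_v(tail two layers below the apex of the up-tet of cube n)·|G_{(n, up-tet)}|²`
(`n − (1,0,0)`, piece 0 on even cubes; `n − (1,−1,−1)`, piece 1 on odd cubes) — the tetrahedron pair of `p1Field_vertical_sub_*` re-indexed by cube; provided the
right-hand family is summable.  NOT a proof of H12⋆, NOT summit progress. -/
theorem tsum_readout_vertical_le {a h : ℝ} (ha : a ≠ 0) (hh : h ≠ 0) (V : ℤ × ℤ × ℤ → (Fin 3 → ℝ)) (wv : ℤ × ℤ × ℤ → ℝ)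
    (hwv : ∀ q, 0 ≤ wv q)
    (hs : Summable fun n : ℤ × ℤ × ℤ =>
      2 * h ^ 2 * wv (n + (if Even n.1 then ((0 : ℤ), (1 : ℤ), (1 : ℤ)) else 0)) * fpFrob (p1CellGrad a h V (n, if Even n.1 then (1 : Fin 6) else 0)) +
      2 * h ^ 2 * wv (n - (if Even n.1 then ((1 : ℤ), (0 : ℤ), (0 : ℤ)) else (1, -1, -1))) *
        fpFrob (p1CellGrad a h V (n, if Even n.1 then (0 : Fin 6) else 1))) :
    Summable (fun q => wv q * fpSq (fun k => V (q + (2, 0, 0)) k - V q k)) ∧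
    ∑' q, wv q * fpSq (fun k => V (q + (2, 0, 0)) k - V q k) ≤
    ∑' n : ℤ × ℤ × ℤ,
      (2 * h ^ 2 * wv (n + (if Even n.1 then ((0 : ℤ), (1 : ℤ), (1 : ℤ)) else 0)) * fpFrob (p1CellGrad a h V (n, if Even n.1 then (1 : Fin 6) else 0)) +
      2 * h ^ 2 * wv (n - (if Even n.1 then ((1 : ℤ), (0 : ℤ), (0 : ℤ)) else (1, -1, -1))) *
        fpFrob (p1CellGrad a h V (n, if Even n.1 then (0 : Fin 6) else 1))) := by
  set C1 : ℤ × ℤ × ℤ → ℝ := fun n => 2 * h ^ 2 * wv (n + (if Even n.1 then ((0 : ℤ), (1 : ℤ), (1 : ℤ)) else 0)) *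
    fpFrob (p1CellGrad a h V (n, if Even n.1 then (1 : Fin 6) else 0)) with hC1
  set C2 : ℤ × ℤ × ℤ → ℝ := fun n => 2 * h ^ 2 * wv (n - (if Even n.1 then ((1 : ℤ), (0 : ℤ), (0 : ℤ)) else (1, -1, -1))) *
    fpFrob (p1CellGrad a h V (n, if Even n.1 then (0 : Fin 6) else 1)) with hC2
  -- the bond-indexed bounding families
  set D1 : ℤ × ℤ × ℤ → ℝ := fun q => 2 * h ^ 2 * wv q *
    fpFrob (p1CellGrad a h V (if Even q.1 then (q + (0, -1, -1), 1) else (q, 0))) with hD1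
  set D2 : ℤ × ℤ × ℤ → ℝ := fun q => 2 * h ^ 2 * wv q *
    fpFrob (p1CellGrad a h V (if Even q.1 then (q + (1, -1, -1), 1) else (q + (1, 0, 0), 0))) with hD2
  have hF0 : ∀ i, 0 ≤ fpFrob (p1CellGrad a h V i) := fun i => by unfold fpFrob; positivity
  have hS0 : ∀ f : Fin 3 → ℝ, 0 ≤ fpSq f := fun f => by unfold fpSq; positivity
  have hh2 : 0 ≤ 2 * h ^ 2 := by positivity
  have hC10 : ∀ n, 0 ≤ C1 n := fun n => mul_nonneg (mul_nonneg hh2 (hwv _)) (hF0 _)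
  have hC20 : ∀ n, 0 ≤ C2 n := fun n => mul_nonneg (mul_nonneg hh2 (hwv _)) (hF0 _)
  have hsC1 : Summable C1 := Summable.of_nonneg_of_le hC10 (fun n => by linarith [hC20 n]) hs
  have hsC2 : Summable C2 := Summable.of_nonneg_of_le hC20 (fun n => by linarith [hC10 n]) hs
  -- the two re-indexing bijections (parity-preserving shift / parity-flipping shift)
  let e₁ : ℤ × ℤ × ℤ ≃ ℤ × ℤ × ℤ :=
    { toFun := fun q => if Even q.1 then q + (0, -1, -1) else q
      invFun := fun n => if Even n.1 then n + (0, 1, 1) else n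
      left_inv := fun q => by
        by_cases hq : Even q.1
        · have : Even (q + ((0 : ℤ), (-1 : ℤ), (-1 : ℤ))).1 := by simpa using hq
          simp only [hq, if_true, this]; ext <;> simp
        · simp [hq]
      right_inv := fun n => by
        by_cases hn : Even n.1
        · have : Even (n + ((0 : ℤ), (1 : ℤ), (1 : ℤ))).1 := by simpa using hn
          simp only [hn, if_true, this]; ext <;> simp
        · simp [hn] }
  let e₂ : ℤ × ℤ × ℤ ≃ ℤ × ℤ × ℤ :=
    { toFun := fun q => if Even q.1 then q + (1, -1, -1) else q + (1, 0, 0)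
      invFun := fun n => if Even n.1 then n - (1, 0, 0) else n - (1, -1, -1)
      left_inv := fun q => by
        by_cases hq : Even q.1
        · have : ¬ Even (q + ((1 : ℤ), (-1 : ℤ), (-1 : ℤ))).1 := by
            simp only [Prod.fst_add, Int.not_even_iff_odd]; exact hq.add_one
          simp only [hq, if_true, this, if_false]; ext <;> simp
        · have : Even (q + ((1 : ℤ), (0 : ℤ), (0 : ℤ))).1 := by
            simp only [Prod.fst_add]; exact (Int.not_even_iff_odd.1 hq).add_one
          simp only [hq, if_false, this, if_true]; ext <;> simp
      right_inv := fun n => by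
        by_cases hn : Even n.1
        · have : ¬ Even (n - ((1 : ℤ), (0 : ℤ), (0 : ℤ))).1 := by
            simp only [Prod.fst_sub, Int.not_even_iff_odd]; exact hn.sub_odd odd_one
          simp only [hn, if_true, this, if_false]; ext <;> simp
        · have : Even (n - ((1 : ℤ), (-1 : ℤ), (-1 : ℤ))).1 := by
            simp only [Prod.fst_sub]; exact (Int.not_even_iff_odd.1 hn).sub_odd odd_one
          simp only [hn, if_false, this, if_true]; ext <;> simp }
  -- D_i = C_i ∘ e_i
  have hDC1 : ∀ q, D1 q = C1 (e₁ q) := by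
    intro q
    by_cases hq : Even q.1
    · have he : e₁ q = q + (0, -1, -1) := if_pos hq
      have : Even (q + ((0 : ℤ), (-1 : ℤ), (-1 : ℤ))).1 := by simpa using hq
      simp only [hD1, hC1, he, hq, this, if_true]
      congr 2
      · congr 1; ext <;> simp
    · have he : e₁ q = q := if_neg hq
      simp only [hD1, hC1, he, hq, if_false, add_zero]
  have hDC2 : ∀ q, D2 q = C2 (e₂ q) := by
    intro q
    by_cases hq : Even q.1
    · have he : e₂ q = q + (1, -1, -1) := if_pos hq
      have : ¬ Even (q + ((1 : ℤ), (-1 : ℤ), (-1 : ℤ))).1 := by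
        simp only [Prod.fst_add, Int.not_even_iff_odd]; exact hq.add_one
      simp only [hD2, hC2, he, hq, this, if_true, if_false, add_sub_cancel_right]
    · have he : e₂ q = q + (1, 0, 0) := if_neg hq
      have : Even (q + ((1 : ℤ), (0 : ℤ), (0 : ℤ))).1 := by
        simp only [Prod.fst_add]; exact (Int.not_even_iff_odd.1 hq).add_one
      simp only [hD2, hC2, he, hq, this, if_true, if_false, add_sub_cancel_right]
  have hsD1 : Summable D1 := by
    have : D1 = C1 ∘ e₁ := funext hDC1
    rw [this]; exact (e₁.summable_iff).2 hsC1
  have hsD2 : Summable D2 := by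
    have : D2 = C2 ∘ e₂ := funext hDC2
    rw [this]; exact (e₂.summable_iff).2 hsC2
  have htD1 : ∑' q, D1 q = ∑' n, C1 n := by rw [show D1 = C1 ∘ e₁ from funext hDC1]; exact e₁.tsum_eq C1
  have htD2 : ∑' q, D2 q = ∑' n, C2 n := by rw [show D2 = C2 ∘ e₂ from funext hDC2]; exact e₂.tsum_eq C2
  -- termwise bound
  have hle : ∀ q, wv q * fpSq (fun k => V (q + (2, 0, 0)) k - V q k) ≤ D1 q + D2 q := by
    intro q
    by_cases hq : Even q.1
    · have hb := mul_le_mul_of_nonneg_left (p1_vertical_readout_le_even ha hh V q hq) (hwv q)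
      simp only [hD1, hD2, hq, if_true]
      nlinarith [hb]
    · have hb := mul_le_mul_of_nonneg_left (p1_vertical_readout_le_odd ha hh V q (Int.not_even_iff_odd.1 hq)) (hwv q)
      simp only [hD1, hD2, hq, if_false]
      nlinarith [hb]
  have hb0 : ∀ q, 0 ≤ wv q * fpSq (fun k => V (q + (2, 0, 0)) k - V q k) := fun q => mul_nonneg (hwv q) (hS0 _)
  have hsD : Summable fun q => D1 q + D2 q := hsD1.add hsD2
  have hbond : Summable (fun q => wv q * fpSq (fun k => V (q + (2, 0, 0)) k - V q k)) := Summable.of_nonneg_of_le hb0 hle hsD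
  refine ⟨hbond, ?_⟩
  have hcell : (fun n : ℤ × ℤ × ℤ =>
      2 * h ^ 2 * wv (n + (if Even n.1 then ((0 : ℤ), (1 : ℤ), (1 : ℤ)) else 0)) * fpFrob (p1CellGrad a h V (n, if Even n.1 then (1 : Fin 6) else 0)) +
      2 * h ^ 2 * wv (n - (if Even n.1 then ((1 : ℤ), (0 : ℤ), (0 : ℤ)) else (1, -1, -1))) *
        fpFrob (p1CellGrad a h V (n, if Even n.1 then (0 : Fin 6) else 1))) = fun n => C1 n + C2 n := rfl
  rw [hcell]
  calc ∑' q, wv q * fpSq (fun k => V (q + (2, 0, 0)) k - V q k)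
      ≤ ∑' q, (D1 q + D2 q) := Summable.tsum_le_tsum hle hbond hsD
    _ = (∑' q, D1 q) + ∑' q, D2 q := hsD1.tsum_add hsD2
    _ = (∑' n, C1 n) + ∑' n, C2 n := by rw [htD1, htD2]
    _ = ∑' n, (C1 n + C2 n) := (hsC1.tsum_add hsC2).symm

end Summit.AtomisticToContinuum.Crystallization.Theorems.StrictSplittingRuleBirth
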